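import Mathlib
import HarnessLib
import HarnessLib.Audit
import Summits.QuantumFields.YangMills.Theses.PencilRigidity
import Summits.QuantumFields.YangMills.Theorems.PencilRigidityCurvatureKernelBoundKernelPinning

/-!
# Line `sixteen-charts-analytic-kernel` — crux `PencilRigidity.CurvatureKernelBound` (stmt-QuantumFields-11687)

Skeleton v2 (line LEAD prover-line-stmt-QuantumFields-11687-0, 2026-08-16), reshaped from the crux-plan skeleton
(planner-cruxplan-…-sixteen-charts-analy-0, 2026-08-15; idea card `Ideas/sixteen-charts-analytic-kernel.md`, triage
r1 3/3 pass).

THE LINE. `CurvatureKernelBound` bundles (i) REGULARITY — the two-point function of the curvature channel `S₁` is, on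
`⁰𝒮`, a kernel `K(x₀ − x₁)` continuous on `ℝ⁴ ∖ 0`, real, bounded at infinity — and (ii) ORDER — `|K x| ≤ C |x|^(η−10)`
near `0`. The lever: at every `x ≠ 0` the normals `n` of the 16 lattice mirrors with `x·n ≠ 0` span `ℝ⁴`, and
reflection positivity across each mirror is a one-sided Laplace chart, so the 16 charts (axis charts from E2 along `e₀`
transported by the proper signed permutations of `W₁`; diagonal charts from the route's own crux `DiagonalMirrorRPR`)
make the two-point distribution a continuous function off the origin (`MirrorChartRegularity`). The AXIS charts alone
give the envelope `‖K x‖ ≤ k(‖x‖/2)` by ONE non-negative non-increasing function `k(s) = K(s e₀)` (`AxisEnvelope`),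
reality of `K` comes from the real lattice correlations (`LatticeReality`, LANDED: p71949,
`Theorems/PencilRigidityCurvatureKernelBoundKernelPinning.lean`), and the whole UV content of the crux is the growth of
`k` on `(0,1]` (`AxialGrowth`, the residual open stub). Boundedness at infinity is monotonicity; no gap is used.

RESHAPE (v2, lead): `MirrorChartRegularity` (size XL as one stub) is split at the skeleton level into four registered
stubs whose composition `mirrorChartRegularity_of` is kernel-checked below:
* `ChartDerivativeBounds` (A1, model-blind QFT → analysis interface): for ANY one-species family `S₁` translation
  invariant on `⁰𝒮` and ANY frame `R` in which the pulled-back family is reflection positive, the two-point function on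
  tensors `f ⊗ g` with `f` on the negative side of the mirror `(R e₀)^⊥` and `g` at distance `> δ` on the positive side
  obeys, for every order `N` of PURE derivatives along the normal `R e₀` on either slot, a bound
  `C_N δ^{-p_N} |f|_{M₀} |g|_{M₀}` with ONE Schwartz order `M₀` (OS reconstruction in the frame: `Ψ_{g_t} = e^{-tH}Ψ_g`,
  joint spectral measure, `sup λ^N e^{-δλ/4} = (4N/eδ)^N`; `OSReconstructionNoE1` + `exists_isJointSpectralMeasure_holds`);
* `TensorRegularity` (A2, PURE ANALYSIS, no QFT): a continuous functional `Λ` on `𝓢((ℝ⁴)²)` whose values on tensors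
  `f ⊗ g` (`supp f ⊆ U`, `supp g ⊆ V`) with pure derivatives of order `≤ N₁` along four SPANNING directions on either
  slot are bounded by `|f|_{M₀}|g|_{M₀}` is, near `(x₀, y₀) ∈ U × V`, integration against a continuous bounded kernel
  `K₂` — with `N₁`, the radius and the bound depending only on the geometry and `M₀` (Fourier decay of
  `Λ((χ₁e_ξ) ⊗ (χ₂e_η))` faster than `(1+|ξ|+|η|)^{2M₀-N₁}`, Fourier inversion; Mathlib `SchwartzMap.fourierTransformCLE`,
  `Real.fourierIntegral` self-adjointness);
* `KernelOffDiagonal` (A3, assembly off the diagonal): A1 ∧ A2 ∧ the hypotheses of `MirrorChartRegularity` ⇒ a kernel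
  `K` continuous on `ℝ⁴ ∖ 0`, POLYNOMIALLY bounded at `0` and `∞`, representing `S₁ 2` on COMPACTLY supported test
  functions supported off the diagonal (frames for the 32 oriented mirror normals from E2 + proper signed permutations +
  the four diagonal frames; at `x − y ≠ 0` four independent good normals, `Literature…LatticeMirrorNormals`-style; local
  kernels patched by uniqueness; translation invariance ⇒ `K₂(x,y) = K(x−y)`; the polynomial a-priori bound from A2's
  UNIFORM constants applied to the dilated families `S₁ ∘ D_λ`, using A1's explicit `δ^{-p}`);
* `OffDiagonalExtension` (A4, PURE ANALYSIS): a continuous functional `T` on `𝓢((ℝ⁴)²)` represented by a polynomially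
  bounded continuous-off-`0` kernel on compactly supported test functions supported off the diagonal is represented by
  it, with absolutely integrable integrand, on all of `⁰𝒮` (flatness of `F ∈ ⁰𝒮` on the diagonal ⇒ `|F| ≲ |x₀−x₁|^m`;
  cut-offs at the diagonal and at infinity converge in `𝓢`; dominated convergence).
`Stub.MirrorChartRegularity` is thereby retired (PROVED modulo A1–A4); `Stub.LatticeReality` is retired (LANDED).
Registered stubs after v2 (7 = stubs_max): `DiagonalMirrorRPR` (= route item stmt-QuantumFields-10604),
`ChartDerivativeBounds`, `TensorRegularity`, `KernelOffDiagonal`, `OffDiagonalExtension`, `AxisEnvelope`, `AxialGrowth`.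

Composition (kernel-checked below, no `sorry` outside the stubs):
`DiagonalMirrorRPR → (A1 → A2 → A3 → A4 ⇒ MirrorChartRegularity) → AxisEnvelope → LatticeReality → AxialGrowth →
CurvatureKernelBound`, with `K_real := re ∘ K`, `C_total := k(1/2) + |C| / 2^(η−10)`.

Disproof.lean (cdisprove part II, crux-written, read 2026-08-16 — snapshot `work/Disproof_snapshot.lean` of the lead's
folder): no `_false_without_` theorem, no landed Negative lemma, `§E Targets` empty; honoured: §B (UV scaling = exact
content of the bound: lives in `AxialGrowth` only), §C pinning (`kernel_unique` ⇒ `AxialGrowth`/`LatticeReality` may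
quantify over EVERY continuous representing kernel; re-landed def-free as `kernel_unique_of_realTensor`), §D near-miss
(16-mirror RP does not bound the ORDER — consistent: A1–A4 and `AxisEnvelope` claim no order), §G
(`not_representable_T0_L8`: dressed free two-point CLMs have NO kernel with the crux's bound — they fail `AxialGrowth`,
not regularity).
-/

namespace Summit.QuantumFields.YangMills.Cruxes.CurvatureKernelBound.SixteenChartsAnalyticKernel

open scoped BigOperators Topology ComplexConjugate
open Filter Set Function TopologicalSpace MeasureTheory
open Literature.MathematicalPhysics.QuantumLattice Literature.MathematicalPhysics.AQFT Literature.MathematicalPhysics.QuantumFieldTheory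

/-! ## The statements (precise `Prop`s, taken BY NAME as hypotheses of the glue; their sorried witnesses `Stub.<Name>`
below are the REGISTERED stubs — signatures verbatim, let-free, `open … in`-prefixed) -/

/-- **A · MirrorChartRegularity** (the LEVER; no longer a stub: PROVED below from A1–A4). For a one-species Schwinger
family `S₁` on `ℝ⁴` with the OS package of `W₁`, translation invariance and proper signed-permutation invariance on `⁰𝒮`,
and reflection positivity in pull-back form for the four diagonal frames `R e₀ = a e₀ + b e₁`, `a² = b² = 1/2`: the
two-point function is, on `⁰𝒮`, integration against a COMPLEX kernel `K(x₀ − x₁)` continuous on `ℝ⁴ ∖ 0`.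
[GlimmJaffe1987 §6.1, Cor. 19.5.6; OsterwalderSchrader1973 §4; OsterwalderSchrader1975 Thm 4.1] -/
def MirrorChartRegularity : Prop :=
  open Literature.MathematicalPhysics.QuantumLattice Literature.MathematicalPhysics.AQFT Literature.MathematicalPhysics.QuantumFieldTheory in ∀ (S₁ : SchwingerFamily (EuclideanSpace ℝ (Fin 4))), (S₁.toLabelled.IsNormalized ∧ S₁.toLabelled.IsHermitian ∧ S₁.toLabelled.HasLinearGrowth ∧ S₁.toLabelled.IsReflectionPositive ∧ S₁.toLabelled.IsSymmetric ∧ S₁.toLabelled.HasClusterProperty) → (∀ (n : ℕ) (a : (EuclideanSpace ℝ (Fin 4))) (F : SchwartzMap (Fin n → (EuclideanSpace ℝ (Fin 4))) ℂ), IsOffDiagonal F → S₁ n (translateMulti a F) = S₁ n F) → (∀ (R : (EuclideanSpace ℝ (Fin 4)) ≃ₗᵢ[ℝ] (EuclideanSpace ℝ (Fin 4))), LinearMap.det (R.toLinearEquiv : (EuclideanSpace ℝ (Fin 4)) →ₗ[ℝ] (EuclideanSpace ℝ (Fin 4))) = 1 → (∀ i : Fin 4, ∃ j : Fin 4, R (EuclideanSpace.single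 i 1) = EuclideanSpace.single j 1 ∨ R (EuclideanSpace.single i 1) = -EuclideanSpace.single j 1) → ∀ (n : ℕ) (F : SchwartzMap (Fin n → (EuclideanSpace ℝ (Fin 4))) ℂ), IsOffDiagonal F → S₁ n (linActMulti R F) = S₁ n F) → (∀ (R : (EuclideanSpace ℝ (Fin 4)) ≃ₗᵢ[ℝ] (EuclideanSpace ℝ (Fin 4))) (a b : ℝ), a ^ 2 = 1 / 2 → b ^ 2 = 1 / 2 → R (EuclideanSpace.single 0 1) = a • EuclideanSpace.single 0 1 + b • EuclideanSpace.single 1 1 → (SchwingerFamily.toLabelled (fun n => (S₁ n).comp (linActMulti R))).IsReflectionPositive) → ∃ K : (EuclideanSpace ℝ (Fin 4)) → ℂ, ContinuousOn K {x : (EuclideanSpace ℝ (Fin 4)) | x ≠ 0} ∧ (∀ F : SchwartzMap (Fin 2 → (EuclideanSpace ℝ (Fin 4))) ℂ, IsOffDiagonal F → MeasureTheory.Integrable (fun x : Fin 2 → (EuclideanSpace ℝ (Fin 4)) => K (x 0 - x 1) * F x) ∧ S₁ 2 F = ∫ x : Fin 2 → (EuclideanSpace ℝ (Fin 4)), K (x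 0 - x 1) * F x)

/-- **A1 · ChartDerivativeBounds** (model-blind; size L). One frame `R` (normal `n = R e₀`), reflection positivity of
the pulled-back family `S₁ ∘ R` along `e₀` and translation invariance of `S₁` on `⁰𝒮` give, for tensors `f ⊗ g` with
`supp f ⊆ {⟪x,n⟫ < 0}` and `supp g ⊆ {⟪x,n⟫ > δ}` (`0 < δ ≤ 1`; such tensors are in `⁰𝒮`), bounds on
`𝔖₂((∂ₙᴺ f) ⊗ g)` and `𝔖₂(f ⊗ ∂ₙᴺ g)` by `C_N δ^{-p_N} |f|_{M₀} |g|_{M₀}` with ONE order `M₀` for all `N`.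
Route: in the frame, `f = Θ(f')*` with `f'` positive-time, `𝔖₂^R(Θf'* ⊗ g_t) = ⟪Ψ_{f'}, e^{-(t+δ/4)H} Ψ_{g_{-δ/4}}⟫ =
∫ e^{-(t+δ/4)p₀} dσ` (polarisation of four joint spectral measures, `OSReconstructionNoE1.transfer_fieldVec`,
`exists_isJointSpectralMeasure_holds`), `dᴺ/dtᴺ` under the integral, `sup_{λ≥0} λᴺe^{-δλ/4} = (4N/eδ)ᴺ`,
`‖Ψ_f‖² = 𝔖₂(Θf*⊗f) ≤ C_S |Θf* ⊗ f|_{M} ≤ C |f|_{M}²` (temperedness of the single CLM `S₁ 2` + `SchwartzMap.decay_mul_comp`),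
product form by scaling `f ↦ λf, g ↦ g/λ`; the identification `dᴺ/dtᴺ 𝔖₂(Θf'* ⊗ g_t) = (-1)ᴺ 𝔖₂(Θf'* ⊗ (∂₀ᴺ g)_t)` is the
derivative of translations in `𝓢` tested against a continuous functional (mean-value estimate seminorm by seminorm);
the first-slot case is the adjoint one (`Θ`, conjugation). [OsterwalderSchrader1973 §4.1 (4.6)–(4.10); GlimmJaffe1987
Thm 6.1.3] -/
def ChartDerivativeBounds : Prop :=
  open Literature.MathematicalPhysics.QuantumLattice Literature.MathematicalPhysics.AQFT Literature.MathematicalPhysics.QuantumFieldTheory in ∀ (S₁ : SchwingerFamily (EuclideanSpace ℝ (Fin 4))) (R : (EuclideanSpace ℝ (Fin 4)) ≃ₗᵢ[ℝ] (EuclideanSpace ℝ (Fin 4))), (SchwingerFamily.toLabelled (fun n => (S₁ n).comp (linActMulti R))).IsReflectionPositive → (∀ (n : ℕ) (a : (EuclideanSpace ℝ (Fin 4))) (F : SchwartzMap (Fin n → (EuclideanSpace ℝ (Fin 4))) ℂ), IsOffDiagonal F → S₁ n (translateMulti a F) = S₁ n F) → ∃ M₀ : ℕ, ∀ N : ℕ,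 ∃ (C : ℝ) (p : ℕ), ∀ δ : ℝ, 0 < δ → δ ≤ 1 → ∀ (f g : SchwartzMap (EuclideanSpace ℝ (Fin 4)) ℂ), tsupport (f : (EuclideanSpace ℝ (Fin 4)) → ℂ) ⊆ {x : (EuclideanSpace ℝ (Fin 4)) | inner ℝ x (R (EuclideanSpace.single 0 1)) < 0} → tsupport (g : (EuclideanSpace ℝ (Fin 4)) → ℂ) ⊆ {x : (EuclideanSpace ℝ (Fin 4)) | δ < inner ℝ x (R (EuclideanSpace.single 0 1))} → ∀ F : SchwartzMap (Fin 2 → (EuclideanSpace ℝ (Fin 4))) ℂ, (IsTensorOf F ![((LineDeriv.lineDerivOp (R (EuclideanSpace.single 0 1)) : SchwartzMap (EuclideanSpace ℝ (Fin 4)) ℂ → SchwartzMap (EuclideanSpace ℝ (Fin 4)) ℂ)^[N] f), g] ∨ IsTensorOf F ![f, ((LineDeriv.lineDerivOp (R (EuclideanSpace.single 0 1)) : SchwartzMap (EuclideanSpace ℝ (Fin 4)) ℂ → SchwartzMap (EuclideanSpace ℝ (Fin 4)) ℂ)^[N] g)]) → ‖S₁ 2 F‖ ≤ C * (1 / δ)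 ^ p * schwartzNorm M₀ f * schwartzNorm M₀ g

/-- **A2 · TensorRegularity** (PURE ANALYSIS; size L–XL). A continuous functional `Λ` on `𝓢((ℝ⁴)², ℂ)` whose values on
tensors `f ⊗ g` (`supp f ⊆ U`, `supp g ⊆ V`, `U, V` open) with pure derivatives of order `N ≤ N₁` along four linearly
independent directions `v_j` on either slot are bounded by `|f|_{M₀} |g|_{M₀}` is, on the product of balls of radius
`ρ` about `(x₀, y₀) ∈ U × V`, integration against a continuous kernel `K₂` bounded by `B` — where `N₁, ρ, B` depend only
on `v, U, V, x₀, y₀, M₀` (this uniformity is what A3 uses on dilated families). Route: cut-offs `χ₁ ⊗ χ₂` equal to `1`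
near the balls; `ĝ(ξ,η) := Λ((χ₁e_{-ξ}) ⊗ (χ₂e_{-η}))` (plane waves ARE tensors) obeys `|⟪ξ,v_j⟫|ᴺ |ĝ| ≲ (1+|ξ|)^{M₀}
(1+|η|)^{M₀}` (Leibniz, induction on `N`, hypothesis on the finite family of derived cut-offs) and the same in `η`;
spanning ⇒ `|ĝ| ≲ (1+|ξ|+|η|)^{2M₀−N₁} ∈ L¹` for `N₁ > 2M₀ + 9`; `K₂ := 𝓕⁻¹ĝ` is continuous and bounded; for `F`
supported in the balls `Λ F = Λ((χ₁⊗χ₂)·𝓕⁻¹𝓕F) = ∫ 𝓕F · ĝ = ∫ F K₂` (exchange of `Λ` with the `ξ`-integral through a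
finite-order Banach completion / Hahn–Banach, then Fourier self-adjointness `∫ 𝓕f·g = ∫ f·𝓕g`). Work on
`EuclideanSpace ℝ (Fin 2 × Fin 4)` or `Fin 8` and transport along the currying isometry. [Hörmander ALPDO I Thm 7.1.14,
Lemma 8.1.1 (the pure-derivative/Fourier-decay mechanism); folklore] -/
def TensorRegularity : Prop :=
  open Literature.MathematicalPhysics.QuantumLattice Literature.MathematicalPhysics.AQFT Literature.MathematicalPhysics.QuantumFieldTheory in ∀ (v : Fin 4 → (EuclideanSpace ℝ (Fin 4))), LinearIndependent ℝ v → ∀ (U V : Set (EuclideanSpace ℝ (Fin 4))), IsOpen U → IsOpen V → ∀ (x₀ y₀ : (EuclideanSpace ℝ (Fin 4))), x₀ ∈ U → y₀ ∈ V → ∀ M₀ : ℕ, ∃ (N₁ : ℕ) (ρ B : ℝ), 0 < ρ ∧ ∀ Λ : SchwartzMap (Fin 2 → (EuclideanSpace ℝ (Fin 4))) ℂ →L[ℂ] ℂ, (∀ (j : Fin 4) (N : ℕ), N ≤ N₁ → ∀ (f g : SchwartzMap (EuclideanSpace ℝ (Fin 4)) ℂ), tsupport (f : (EuclideanSpace ℝ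 (Fin 4)) → ℂ) ⊆ U → tsupport (g : (EuclideanSpace ℝ (Fin 4)) → ℂ) ⊆ V → ∀ F : SchwartzMap (Fin 2 → (EuclideanSpace ℝ (Fin 4))) ℂ, (IsTensorOf F ![((LineDeriv.lineDerivOp (v j) : SchwartzMap (EuclideanSpace ℝ (Fin 4)) ℂ → SchwartzMap (EuclideanSpace ℝ (Fin 4)) ℂ)^[N] f), g] ∨ IsTensorOf F ![f, ((LineDeriv.lineDerivOp (v j) : SchwartzMap (EuclideanSpace ℝ (Fin 4)) ℂ → SchwartzMap (EuclideanSpace ℝ (Fin 4)) ℂ)^[N] g)]) → ‖Λ F‖ ≤ schwartzNorm M₀ f * schwartzNorm M₀ g) → ∃ K₂ : (Fin 2 → (EuclideanSpace ℝ (Fin 4))) → ℂ, ContinuousOn K₂ {x : Fin 2 → (EuclideanSpace ℝ (Fin 4)) | x 0 ∈ Metric.ball x₀ ρ ∧ x 1 ∈ Metric.ball y₀ ρ} ∧ (∀ x : Fin 2 → (EuclideanSpace ℝ (Fin 4)), x 0 ∈ Metric.ball x₀ ρ → x 1 ∈ Metric.ball y₀ ρ → ‖K₂ x‖ ≤ B)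 ∧ ∀ F : SchwartzMap (Fin 2 → (EuclideanSpace ℝ (Fin 4))) ℂ, tsupport (F : (Fin 2 → (EuclideanSpace ℝ (Fin 4))) → ℂ) ⊆ {x : Fin 2 → (EuclideanSpace ℝ (Fin 4)) | x 0 ∈ Metric.ball x₀ ρ ∧ x 1 ∈ Metric.ball y₀ ρ} → MeasureTheory.Integrable (fun x : Fin 2 → (EuclideanSpace ℝ (Fin 4)) => K₂ x * F x) ∧ Λ F = ∫ x : Fin 2 → (EuclideanSpace ℝ (Fin 4)), K₂ x * F x

/-- **A3 · KernelOffDiagonal** (assembly off the diagonal; size XL). From A1, A2 and the hypotheses of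
`MirrorChartRegularity`: a kernel `K : ℝ⁴ → ℂ`, continuous on `ℝ⁴ ∖ 0`, polynomially bounded at `0` and `∞`
(`‖K x‖ ≤ A(‖x‖ᵖ + ‖x‖⁻ᵖ)`), representing `S₁ 2` on compactly supported test functions supported off the diagonal.
Route: (i) frames — for each oriented unit normal `n ∈ {±e_μ} ∪ {(±e_μ ± e_ν)/√2}` an isometry `R_n`, `R_n e₀ = n`, with
`S₁ ∘ R_n` reflection positive (E2 + proper signed permutations, which are symmetries of `S₁` on `⁰𝒮` and permute the 32
normals transitively within the axis / diagonal classes; the four diagonal frames are the hypothesis); (ii) at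
`ξ = x − y ≠ 0` four linearly independent such `n_j` with `⟪ξ, n_j⟫ < 0` (cf. `span_latticeMirrorNormals_inner_ne_zero`);
(iii) A1 in each frame (translate the configuration along `n_j` into position; `|f_b|_M ≤ (1+‖b‖)^M |f|_M`), normalise
the finitely many constants, A2 at `(x, y)` ⇒ local continuous kernels; (iv) patch (two continuous kernels representing
the same functional on an open set agree: `kernel_unique_of_realTensor` / `OSPointwiseAnalyticity.eqOn_of_forall_integral_mul_eq`),
translation invariance ⇒ `K₂(x, y) = K(x − y)`; (v) representation for compactly supported `F` off the diagonal by a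
finite smooth partition of unity; (vi) the polynomial bound: apply (iii) to the dilated families `S₁ ∘ D_λ` (all
hypotheses are dilation covariant; A1's `δ^{-p}` and the seminorms scale polynomially in `λ`, A2's `N₁, ρ, B` do not
move) — `sup_{unit shell} |K(λ·)| ≤ poly(λ, λ⁻¹)`. [folklore] -/
def KernelOffDiagonal : Prop :=
  open Literature.MathematicalPhysics.QuantumLattice Literature.MathematicalPhysics.AQFT Literature.MathematicalPhysics.QuantumFieldTheory in (∀ (S₁ : SchwingerFamily (EuclideanSpace ℝ (Fin 4))) (R : (EuclideanSpace ℝ (Fin 4)) ≃ₗᵢ[ℝ] (EuclideanSpace ℝ (Fin 4))), (SchwingerFamily.toLabelled (fun n => (S₁ n).comp (linActMulti R))).IsReflectionPositive → (∀ (n : ℕ) (a : (EuclideanSpace ℝ (Fin 4))) (F : SchwartzMap (Fin n → (EuclideanSpace ℝ (Fin 4))) ℂ), IsOffDiagonal F → S₁ n (translateMulti a F) = S₁ n F) → ∃ M₀ : ℕ, ∀ N : ℕ, ∃ (C : ℝ) (p : ℕ), ∀ δ : ℝ, 0 < δ → δ ≤ 1 → ∀ (f g : SchwartzMap (EuclideanSpace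 ℝ (Fin 4)) ℂ), tsupport (f : (EuclideanSpace ℝ (Fin 4)) → ℂ) ⊆ {x : (EuclideanSpace ℝ (Fin 4)) | inner ℝ x (R (EuclideanSpace.single 0 1)) < 0} → tsupport (g : (EuclideanSpace ℝ (Fin 4)) → ℂ) ⊆ {x : (EuclideanSpace ℝ (Fin 4)) | δ < inner ℝ x (R (EuclideanSpace.single 0 1))} → ∀ F : SchwartzMap (Fin 2 → (EuclideanSpace ℝ (Fin 4))) ℂ, (IsTensorOf F ![((LineDeriv.lineDerivOp (R (EuclideanSpace.single 0 1)) : SchwartzMap (EuclideanSpace ℝ (Fin 4)) ℂ → SchwartzMap (EuclideanSpace ℝ (Fin 4)) ℂ)^[N] f), g] ∨ IsTensorOf F ![f, ((LineDeriv.lineDerivOp (R (EuclideanSpace.single 0 1)) : SchwartzMap (EuclideanSpace ℝ (Fin 4)) ℂ → SchwartzMap (EuclideanSpace ℝ (Fin 4)) ℂ)^[N] g)]) → ‖S₁ 2 F‖ ≤ C * (1 / δ) ^ p * schwartzNorm M₀ f * schwartzNorm M₀ g) → (∀ (v : Fin 4 → (EuclideanSpace ℝ (Fin 4))), LinearIndependent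 ℝ v → ∀ (U V : Set (EuclideanSpace ℝ (Fin 4))), IsOpen U → IsOpen V → ∀ (x₀ y₀ : (EuclideanSpace ℝ (Fin 4))), x₀ ∈ U → y₀ ∈ V → ∀ M₀ : ℕ, ∃ (N₁ : ℕ) (ρ B : ℝ), 0 < ρ ∧ ∀ Λ : SchwartzMap (Fin 2 → (EuclideanSpace ℝ (Fin 4))) ℂ →L[ℂ] ℂ, (∀ (j : Fin 4) (N : ℕ), N ≤ N₁ → ∀ (f g : SchwartzMap (EuclideanSpace ℝ (Fin 4)) ℂ), tsupport (f : (EuclideanSpace ℝ (Fin 4)) → ℂ) ⊆ U → tsupport (g : (EuclideanSpace ℝ (Fin 4)) → ℂ) ⊆ V → ∀ F : SchwartzMap (Fin 2 → (EuclideanSpace ℝ (Fin 4))) ℂ, (IsTensorOf F ![((LineDeriv.lineDerivOp (v j) : SchwartzMap (EuclideanSpace ℝ (Fin 4)) ℂ → SchwartzMap (EuclideanSpace ℝ (Fin 4)) ℂ)^[N] f), g] ∨ IsTensorOf F ![f, ((LineDeriv.lineDerivOp (v j) : SchwartzMap (EuclideanSpace ℝ (Fin 4)) ℂ → SchwartzMap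 (EuclideanSpace ℝ (Fin 4)) ℂ)^[N] g)]) → ‖Λ F‖ ≤ schwartzNorm M₀ f * schwartzNorm M₀ g) → ∃ K₂ : (Fin 2 → (EuclideanSpace ℝ (Fin 4))) → ℂ, ContinuousOn K₂ {x : Fin 2 → (EuclideanSpace ℝ (Fin 4)) | x 0 ∈ Metric.ball x₀ ρ ∧ x 1 ∈ Metric.ball y₀ ρ} ∧ (∀ x : Fin 2 → (EuclideanSpace ℝ (Fin 4)), x 0 ∈ Metric.ball x₀ ρ → x 1 ∈ Metric.ball y₀ ρ → ‖K₂ x‖ ≤ B) ∧ ∀ F : SchwartzMap (Fin 2 → (EuclideanSpace ℝ (Fin 4))) ℂ, tsupport (F : (Fin 2 → (EuclideanSpace ℝ (Fin 4))) → ℂ) ⊆ {x : Fin 2 → (EuclideanSpace ℝ (Fin 4)) | x 0 ∈ Metric.ball x₀ ρ ∧ x 1 ∈ Metric.ball y₀ ρ} → MeasureTheory.Integrable (fun x : Fin 2 → (EuclideanSpace ℝ (Fin 4)) => K₂ x * F x) ∧ Λ F = ∫ x : Fin 2 → (EuclideanSpace ℝ (Fin 4)), K₂ x * F x) → ∀ (S₁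 : SchwingerFamily (EuclideanSpace ℝ (Fin 4))), (S₁.toLabelled.IsNormalized ∧ S₁.toLabelled.IsHermitian ∧ S₁.toLabelled.HasLinearGrowth ∧ S₁.toLabelled.IsReflectionPositive ∧ S₁.toLabelled.IsSymmetric ∧ S₁.toLabelled.HasClusterProperty) → (∀ (n : ℕ) (a : (EuclideanSpace ℝ (Fin 4))) (F : SchwartzMap (Fin n → (EuclideanSpace ℝ (Fin 4))) ℂ), IsOffDiagonal F → S₁ n (translateMulti a F) = S₁ n F) → (∀ (R : (EuclideanSpace ℝ (Fin 4)) ≃ₗᵢ[ℝ] (EuclideanSpace ℝ (Fin 4))), LinearMap.det (R.toLinearEquiv : (EuclideanSpace ℝ (Fin 4)) →ₗ[ℝ] (EuclideanSpace ℝ (Fin 4))) = 1 → (∀ i : Fin 4, ∃ j : Fin 4, R (EuclideanSpace.single i 1) = EuclideanSpace.single j 1 ∨ R (EuclideanSpace.single i 1) = -EuclideanSpace.single j 1) → ∀ (n : ℕ) (F : SchwartzMap (Fin n → (EuclideanSpace ℝ (Fin 4))) ℂ), IsOffDiagonal F → S₁ n (linActMulti R F) = S₁ n F) → (∀ (R :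 (EuclideanSpace ℝ (Fin 4)) ≃ₗᵢ[ℝ] (EuclideanSpace ℝ (Fin 4))) (a b : ℝ), a ^ 2 = 1 / 2 → b ^ 2 = 1 / 2 → R (EuclideanSpace.single 0 1) = a • EuclideanSpace.single 0 1 + b • EuclideanSpace.single 1 1 → (SchwingerFamily.toLabelled (fun n => (S₁ n).comp (linActMulti R))).IsReflectionPositive) → ∃ K : (EuclideanSpace ℝ (Fin 4)) → ℂ, ContinuousOn K {x : (EuclideanSpace ℝ (Fin 4)) | x ≠ 0} ∧ (∃ (A : ℝ) (p : ℕ), ∀ x : (EuclideanSpace ℝ (Fin 4)), x ≠ 0 → ‖K x‖ ≤ A * (‖x‖ ^ p + ‖x‖⁻¹ ^ p)) ∧ ∀ F : SchwartzMap (Fin 2 → (EuclideanSpace ℝ (Fin 4))) ℂ, HasCompactSupport (F : (Fin 2 → (EuclideanSpace ℝ (Fin 4))) → ℂ) → tsupport (F : (Fin 2 → (EuclideanSpace ℝ (Fin 4))) → ℂ) ⊆ {x : Fin 2 → (EuclideanSpace ℝ (Fin 4)) | x 0 ≠ x 1} → MeasureTheory.Integrable (fun x : Fin 2 → (EuclideanSpace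 ℝ (Fin 4)) => K (x 0 - x 1) * F x) ∧ S₁ 2 F = ∫ x : Fin 2 → (EuclideanSpace ℝ (Fin 4)), K (x 0 - x 1) * F x

/-- **A4 · OffDiagonalExtension** (PURE ANALYSIS; size L). A continuous functional `T` on `𝓢((ℝ⁴)², ℂ)` represented
by a continuous-off-`0`, polynomially bounded kernel `K(x₀ − x₁)` on compactly supported test functions supported off
the diagonal is represented by it on all of `⁰𝒮`, with absolutely integrable integrand. Route: for `F ∈ ⁰𝒮` (flat on
`{x₀ = x₁}`: `iteratedFDeriv` vanishes there) Taylor along the segment to the nearest diagonal point gives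
`‖D^l F(x)‖ ≤ C_{l,m,k} ‖x₀ − x₁‖^m (1 + ‖x‖)^{-k}`; hence `K(x₀−x₁)F` is integrable, and the cut-off functions
`F_{ε,R} := (1 − χ(‖x₀−x₁‖/ε)) η(x/R) F` (compactly supported off the diagonal) converge to `F` in every Schwartz
seminorm (Leibniz; `ε^{-l} ε^{m} → 0`, `R^{-l}(1+R)^{-k+…} → 0`), so `T F_{ε,R} → T F` (`schwartz_withSeminorms`) while
`∫ K F_{ε,R} → ∫ K F` (dominated convergence). [folklore] -/
def OffDiagonalExtension : Prop :=
  open Literature.MathematicalPhysics.QuantumLattice Literature.MathematicalPhysics.AQFT Literature.MathematicalPhysics.QuantumFieldTheory in ∀ (T : SchwartzMap (Fin 2 → (EuclideanSpace ℝ (Fin 4))) ℂ →L[ℂ] ℂ) (K : (EuclideanSpace ℝ (Fin 4)) → ℂ), ContinuousOn K {x : (EuclideanSpace ℝ (Fin 4)) | x ≠ 0} → (∃ (A : ℝ) (p : ℕ), ∀ x : (EuclideanSpace ℝ (Fin 4)), x ≠ 0 → ‖K x‖ ≤ A * (‖x‖ ^ p + ‖x‖⁻¹ ^ p)) → (∀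 F : SchwartzMap (Fin 2 → (EuclideanSpace ℝ (Fin 4))) ℂ, HasCompactSupport (F : (Fin 2 → (EuclideanSpace ℝ (Fin 4))) → ℂ) → tsupport (F : (Fin 2 → (EuclideanSpace ℝ (Fin 4))) → ℂ) ⊆ {x : Fin 2 → (EuclideanSpace ℝ (Fin 4)) | x 0 ≠ x 1} → MeasureTheory.Integrable (fun x : Fin 2 → (EuclideanSpace ℝ (Fin 4)) => K (x 0 - x 1) * F x) ∧ T F = ∫ x : Fin 2 → (EuclideanSpace ℝ (Fin 4)), K (x 0 - x 1) * F x) → ∀ F : SchwartzMap (Fin 2 → (EuclideanSpace ℝ (Fin 4))) ℂ, IsOffDiagonal F → MeasureTheory.Integrable (fun x : Fin 2 → (EuclideanSpace ℝ (Fin 4)) => K (x 0 - x 1) * F x) ∧ T F = ∫ x : Fin 2 → (EuclideanSpace ℝ (Fin 4)), K (x 0 - x 1) * F x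

/-- **B · AxisEnvelope** (model-blind; axis charts only; size M–L). If `K : ℝ⁴ → ℂ`, continuous off `0`, represents the
two-point function of `S₁` on `⁰𝒮`, and `S₁` is reflection positive along `e₀`, translation invariant and
proper-signed-permutation invariant on `⁰𝒮`, then with `k(s) := Re K(s e₀)`: (a) `K(s e₀)` is real and `≥ 0` for
`s > 0`; (b) `k` is non-increasing on `(0,∞)`; (c) the ENVELOPE `‖K x‖ ≤ k(‖x‖/2)` for `x ≠ 0`. Route: E2 in Gram form
on `N` degree-1 terms `c_j · (bump at p_j)`, `p_j⁰ > 0`, shrinking bumps + continuity of `K` at `θp_i − p_j ≠ 0` ⇒ the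
hermitian form `Σ c̄ᵢcⱼ K(θpᵢ − pⱼ)` is PSD; `K ∘ R = K` off `0` for proper signed permutations `R` (change of variables
+ `kernel_unique_of_realTensor`), in particular `K(−x) = K(x)` (`R = −1`, `det = 1` in `d = 4`); (a) = 1×1 minor; (b)
from the OS CONTRACTION `‖e^{-tH}Ψ‖ ≤ ‖Ψ‖` (`OSReconstructionNoE1.norm_transfer_le`, `transfer_fieldVec`,
`inner_fieldVec_fieldVec`) on shrinking bumps — kernel positivity alone would allow `e^{+s}`; (c) 2×2 minor at
`(t,0⃗),(t,y⃗)` ⇒ `‖K ξ‖ ≤ k(|ξ⁰|)`, transported to every axis by `e_μ ↦ e₀, e₀ ↦ −e_μ`, `‖ξ‖ ≤ 2 max_μ |ξ^μ|`, and (b).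
[GlimmJaffe1987 Thm 6.1.3; OsterwalderSchrader1973 (4.6)–(4.9)] -/
def AxisEnvelope : Prop :=
  open Literature.MathematicalPhysics.QuantumLattice Literature.MathematicalPhysics.AQFT Literature.MathematicalPhysics.QuantumFieldTheory in ∀ (S₁ : SchwingerFamily (EuclideanSpace ℝ (Fin 4))) (K : (EuclideanSpace ℝ (Fin 4)) → ℂ), S₁.toLabelled.IsReflectionPositive → (∀ (n : ℕ) (a : (EuclideanSpace ℝ (Fin 4))) (F : SchwartzMap (Fin n → (EuclideanSpace ℝ (Fin 4))) ℂ), IsOffDiagonal F → S₁ n (translateMulti a F) = S₁ n F) → (∀ (R : (EuclideanSpace ℝ (Fin 4)) ≃ₗᵢ[ℝ] (EuclideanSpace ℝ (Fin 4))), LinearMap.det (R.toLinearEquiv : (EuclideanSpace ℝ (Fin 4)) →ₗ[ℝ] (EuclideanSpace ℝ (Fin 4))) = 1 → (∀ i : Fin 4, ∃ j : Fin 4, R (EuclideanSpace.single i 1) = EuclideanSpace.single j 1 ∨ R (EuclideanSpace.single i 1) = -EuclideanSpace.single j 1) → ∀ (n : ℕ) (F : SchwartzMap (Fin n → (EuclideanSpace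 ℝ (Fin 4))) ℂ), IsOffDiagonal F → S₁ n (linActMulti R F) = S₁ n F) → ContinuousOn K {x : (EuclideanSpace ℝ (Fin 4)) | x ≠ 0} → (∀ F : SchwartzMap (Fin 2 → (EuclideanSpace ℝ (Fin 4))) ℂ, IsOffDiagonal F → MeasureTheory.Integrable (fun x : Fin 2 → (EuclideanSpace ℝ (Fin 4)) => K (x 0 - x 1) * F x) ∧ S₁ 2 F = ∫ x : Fin 2 → (EuclideanSpace ℝ (Fin 4)), K (x 0 - x 1) * F x) → (∀ s : ℝ, 0 < s → (K (EuclideanSpace.single 0 s)).im = 0 ∧ 0 ≤ (K (EuclideanSpace.single 0 s)).re) ∧ AntitoneOn (fun s : ℝ => (K (EuclideanSpace.single 0 s)).re) (Set.Ioi 0) ∧ (∀ x : (EuclideanSpace ℝ (Fin 4)), x ≠ 0 → ‖K x‖ ≤ (K (EuclideanSpace.single 0 (‖x‖ / 2))).re)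

/-- **C · LatticeReality** (LANDED, p71949: `Summit.QuantumFields.YangMills.Theorems.CurvatureKernel.LatticeReality`).
A kernel continuous off `0` representing a two-point functional that is REAL on real off-diagonal tensors `f₀ ⊗ f₁` has
zero imaginary part off `0`. [folklore] -/
def LatticeReality : Prop :=
  open Literature.MathematicalPhysics.QuantumLattice Literature.MathematicalPhysics.AQFT Literature.MathematicalPhysics.QuantumFieldTheory in ∀ (S₁ : SchwingerFamily (EuclideanSpace ℝ (Fin 4))) (K : (EuclideanSpace ℝ (Fin 4)) → ℂ), ContinuousOn K {x : (EuclideanSpace ℝ (Fin 4)) | x ≠ 0} → (∀ F : SchwartzMap (Fin 2 → (EuclideanSpace ℝ (Fin 4))) ℂ, IsOffDiagonal F → MeasureTheory.Integrable (fun x : Fin 2 → (EuclideanSpace ℝ (Fin 4)) => K (x 0 - x 1) * F x) ∧ S₁ 2 F = ∫ x : Fin 2 → (EuclideanSpace ℝ (Fin 4)), K (x 0 - x 1) * F x) → (∀ (f : Fin 2 → SchwartzMap (EuclideanSpace ℝ (Fin 4)) ℝ) (F : SchwartzMap (Fin 2 → (EuclideanSpace ℝ (Fin 4))) ℂ), IsTensorOf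 F (fun i => ofRealTest (f i)) → IsOffDiagonal F → (S₁ 2 F).im = 0) → ∀ x : (EuclideanSpace ℝ (Fin 4)), x ≠ 0 → (K x).im = 0

/-- **E · AxialGrowth** (YM-specific; the RESIDUAL UV DATUM = the idea's Transfer `C⁺`, pointwise form; OPEN — held by
the lead). For every compact simple `G`, `r`, `sch` and one-species `S₁` with the curvature package `W₁` (verbatim from
the crux), EVERY kernel `K : ℝ⁴ → ℂ` continuous off `0` that represents `S₁ 2` on `⁰𝒮` (there is at most one off `0`)
satisfies `‖K(s e₀)‖ ≤ C s^(η−10)` for `0 < s ≤ 1`, some `C`, `η > 0`. It is NECESSARY for the crux (pinning) and, given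
A–D, EQUIVALENT to it; one real variable, one non-negative non-increasing (completely monotone) function, Tauberian form
`ν[0,Λ] = O(Λ^(10−η))` for the `H`-spectral weight `ν` of the plaquette state, two powers below the asymptotic-freedom
law. Degenerate `W₁`-inhabitants satisfy it with `η = 10`; the dressed free two-point CLMs of Disproof §G fail exactly
here. [JaffeWitten2000 fn. 2; Balaban1989LargeFieldII; MagnenRivasseauSeneor1993; KravchukQiaoRychkov2021] -/
def AxialGrowth : Prop :=
  open Literature.MathematicalPhysics.QuantumLattice Literature.MathematicalPhysics.AQFT Literature.MathematicalPhysics.QuantumFieldTheory in ∀ (G : Type) [Group G] [TopologicalSpace G] [IsTopologicalGroup G] [CompactSpace G] [MeasurableSpace G] [BorelSpace G], IsCompactSimpleLieGroup G → ∀ (r : LatticeRep G) (sch : SpeciesScheme (YMSpecies G)) (S₁ : SchwingerFamily (EuclideanSpace ℝ (Fin 4))), ((∀ (n : ℕ), n ≠ 0 → ∀ (f : Fin n → SchwartzMap (EuclideanSpace ℝ (Fin 4)) ℝ) (F : SchwartzMap (Fin n → (EuclideanSpace ℝ (Fin 4))) ℂ), IsTensorOf F (fun i => ofRealTest (f i))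 → IsOffDiagonal F → Filter.Tendsto (fun k : ℕ => ((latticeSchwinger r.ρ sch (fun s => s.F) k n (fun _ => r.curvature) f : ℝ) : ℂ)) Filter.atTop (nhds (S₁ n F))) ∧ (S₁.toLabelled.IsNormalized ∧ S₁.toLabelled.IsHermitian ∧ S₁.toLabelled.HasLinearGrowth ∧ S₁.toLabelled.IsReflectionPositive ∧ S₁.toLabelled.IsSymmetric ∧ S₁.toLabelled.HasClusterProperty) ∧ (∀ (n : ℕ) (a : (EuclideanSpace ℝ (Fin 4))) (F : SchwartzMap (Fin n → (EuclideanSpace ℝ (Fin 4))) ℂ), IsOffDiagonal F → S₁ n (translateMulti a F) = S₁ n F) ∧ (∀ (R : (EuclideanSpace ℝ (Fin 4)) ≃ₗᵢ[ℝ] (EuclideanSpace ℝ (Fin 4))), LinearMap.det (R.toLinearEquiv : (EuclideanSpace ℝ (Fin 4)) →ₗ[ℝ] (EuclideanSpace ℝ (Fin 4))) = 1 → (∀ i : Fin 4, ∃ j : Fin 4, R (EuclideanSpace.single i 1) = EuclideanSpace.single j 1 ∨ R (EuclideanSpace.single i 1) = -EuclideanSpace.single j 1) → ∀ (n : ℕ)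 (F : SchwartzMap (Fin n → (EuclideanSpace ℝ (Fin 4))) ℂ), IsOffDiagonal F → S₁ n (linActMulti R F) = S₁ n F) ∧ (∃ Δ : ℝ, 0 < Δ ∧ S₁.toLabelled.HasMassGap Δ ∧ HasLatticeMassGap r sch Δ)) → ∀ (K : (EuclideanSpace ℝ (Fin 4)) → ℂ), ContinuousOn K {x : (EuclideanSpace ℝ (Fin 4)) | x ≠ 0} → (∀ F : SchwartzMap (Fin 2 → (EuclideanSpace ℝ (Fin 4))) ℂ, IsOffDiagonal F → MeasureTheory.Integrable (fun x : Fin 2 → (EuclideanSpace ℝ (Fin 4)) => K (x 0 - x 1) * F x) ∧ S₁ 2 F = ∫ x : Fin 2 → (EuclideanSpace ℝ (Fin 4)), K (x 0 - x 1) * F x) → ∃ C η : ℝ, 0 < η ∧ ∀ s : ℝ, 0 < s → s ≤ 1 → ‖K (EuclideanSpace.single 0 s)‖ ≤ C * s ^ (η - 10)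

/-! ## Registered stubs `Stub.<Name>` (`sorry` lives only here) -/

namespace Stub

/-- Stub D = the route's own crux `PencilRigidity.DiagonalMirrorRPR` (item stmt-QuantumFields-10604, shared with
MirrorModularBoosts; one proof serves both): the four diagonal frames. Consumed by name, never restated. -/
theorem DiagonalMirrorRPR : Summit.QuantumFields.YangMills.Theses.PencilRigidity.DiagonalMirrorRPR := by
  sorry

/-- Stub A1, registered form (statement verbatim = def `ChartDerivativeBounds`). -/
theorem ChartDerivativeBounds : open Literature.MathematicalPhysics.QuantumLattice Literature.MathematicalPhysics.AQFT Literature.MathematicalPhysics.QuantumFieldTheory in ∀ (S₁ : SchwingerFamily (EuclideanSpace ℝ (Fin 4))) (R : (EuclideanSpace ℝ (Fin 4)) ≃ₗᵢ[ℝ] (EuclideanSpace ℝ (Fin 4))), (SchwingerFamily.toLabelled (fun n => (S₁ n).comp (linActMulti R))).IsReflectionPositive → (∀ (n : ℕ) (a : (EuclideanSpace ℝ (Fin 4))) (F : SchwartzMap (Fin n → (EuclideanSpace ℝ (Fin 4))) ℂ), IsOffDiagonal F → S₁ n (translateMulti a F) = S₁ n F) → ∃ M₀ : ℕ, ∀ N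 : ℕ, ∃ (C : ℝ) (p : ℕ), ∀ δ : ℝ, 0 < δ → δ ≤ 1 → ∀ (f g : SchwartzMap (EuclideanSpace ℝ (Fin 4)) ℂ), tsupport (f : (EuclideanSpace ℝ (Fin 4)) → ℂ) ⊆ {x : (EuclideanSpace ℝ (Fin 4)) | inner ℝ x (R (EuclideanSpace.single 0 1)) < 0} → tsupport (g : (EuclideanSpace ℝ (Fin 4)) → ℂ) ⊆ {x : (EuclideanSpace ℝ (Fin 4)) | δ < inner ℝ x (R (EuclideanSpace.single 0 1))} → ∀ F : SchwartzMap (Fin 2 → (EuclideanSpace ℝ (Fin 4))) ℂ, (IsTensorOf F ![((LineDeriv.lineDerivOp (R (EuclideanSpace.single 0 1)) : SchwartzMap (EuclideanSpace ℝ (Fin 4)) ℂ → SchwartzMap (EuclideanSpace ℝ (Fin 4)) ℂ)^[N] f), g] ∨ IsTensorOf F ![f, ((LineDeriv.lineDerivOp (R (EuclideanSpace.single 0 1)) : SchwartzMap (EuclideanSpace ℝ (Fin 4)) ℂ → SchwartzMap (EuclideanSpace ℝ (Fin 4)) ℂ)^[N] g)]) → ‖S₁ 2 F‖ ≤ C *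 (1 / δ) ^ p * schwartzNorm M₀ f * schwartzNorm M₀ g := by
  sorry

/-- Stub A2, registered form (statement verbatim = def `TensorRegularity`). -/
theorem TensorRegularity : open Literature.MathematicalPhysics.QuantumLattice Literature.MathematicalPhysics.AQFT Literature.MathematicalPhysics.QuantumFieldTheory in ∀ (v : Fin 4 → (EuclideanSpace ℝ (Fin 4))), LinearIndependent ℝ v → ∀ (U V : Set (EuclideanSpace ℝ (Fin 4))), IsOpen U → IsOpen V → ∀ (x₀ y₀ : (EuclideanSpace ℝ (Fin 4))), x₀ ∈ U → y₀ ∈ V → ∀ M₀ : ℕ, ∃ (N₁ : ℕ) (ρ B : ℝ), 0 < ρ ∧ ∀ Λ : SchwartzMap (Fin 2 → (EuclideanSpace ℝ (Fin 4))) ℂ →L[ℂ] ℂ, (∀ (j : Fin 4) (N : ℕ), N ≤ N₁ → ∀ (f g : SchwartzMap (EuclideanSpace ℝ (Fin 4)) ℂ), tsupport (f : (EuclideanSpace ℝ (Fin 4)) → ℂ) ⊆ U → tsupport (g : (EuclideanSpace ℝ (Fin 4)) → ℂ) ⊆ V → ∀ F : SchwartzMap (Fin 2 → (EuclideanSpace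 ℝ (Fin 4))) ℂ, (IsTensorOf F ![((LineDeriv.lineDerivOp (v j) : SchwartzMap (EuclideanSpace ℝ (Fin 4)) ℂ → SchwartzMap (EuclideanSpace ℝ (Fin 4)) ℂ)^[N] f), g] ∨ IsTensorOf F ![f, ((LineDeriv.lineDerivOp (v j) : SchwartzMap (EuclideanSpace ℝ (Fin 4)) ℂ → SchwartzMap (EuclideanSpace ℝ (Fin 4)) ℂ)^[N] g)]) → ‖Λ F‖ ≤ schwartzNorm M₀ f * schwartzNorm M₀ g) → ∃ K₂ : (Fin 2 → (EuclideanSpace ℝ (Fin 4))) → ℂ, ContinuousOn K₂ {x : Fin 2 → (EuclideanSpace ℝ (Fin 4)) | x 0 ∈ Metric.ball x₀ ρ ∧ x 1 ∈ Metric.ball y₀ ρ} ∧ (∀ x : Fin 2 → (EuclideanSpace ℝ (Fin 4)), x 0 ∈ Metric.ball x₀ ρ → x 1 ∈ Metric.ball y₀ ρ → ‖K₂ x‖ ≤ B) ∧ ∀ F : SchwartzMap (Fin 2 → (EuclideanSpace ℝ (Fin 4))) ℂ, tsupport (F : (Fin 2 → (EuclideanSpace ℝ (Fin 4))) → ℂ)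 ⊆ {x : Fin 2 → (EuclideanSpace ℝ (Fin 4)) | x 0 ∈ Metric.ball x₀ ρ ∧ x 1 ∈ Metric.ball y₀ ρ} → MeasureTheory.Integrable (fun x : Fin 2 → (EuclideanSpace ℝ (Fin 4)) => K₂ x * F x) ∧ Λ F = ∫ x : Fin 2 → (EuclideanSpace ℝ (Fin 4)), K₂ x * F x := by
  sorry

/-- Stub A3, registered form (statement verbatim = def `KernelOffDiagonal`). -/
theorem KernelOffDiagonal : open Literature.MathematicalPhysics.QuantumLattice Literature.MathematicalPhysics.AQFT Literature.MathematicalPhysics.QuantumFieldTheory in (∀ (S₁ : SchwingerFamily (EuclideanSpace ℝ (Fin 4))) (R : (EuclideanSpace ℝ (Fin 4)) ≃ₗᵢ[ℝ] (EuclideanSpace ℝ (Fin 4))), (SchwingerFamily.toLabelled (fun n => (S₁ n).comp (linActMulti R))).IsReflectionPositive → (∀ (n : ℕ) (a : (EuclideanSpace ℝ (Fin 4))) (F : SchwartzMap (Fin n → (EuclideanSpace ℝ (Fin 4))) ℂ), IsOffDiagonal F → S₁ n (translateMulti a F) = S₁ n F) → ∃ M₀ : ℕ, ∀ N : ℕ,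 ∃ (C : ℝ) (p : ℕ), ∀ δ : ℝ, 0 < δ → δ ≤ 1 → ∀ (f g : SchwartzMap (EuclideanSpace ℝ (Fin 4)) ℂ), tsupport (f : (EuclideanSpace ℝ (Fin 4)) → ℂ) ⊆ {x : (EuclideanSpace ℝ (Fin 4)) | inner ℝ x (R (EuclideanSpace.single 0 1)) < 0} → tsupport (g : (EuclideanSpace ℝ (Fin 4)) → ℂ) ⊆ {x : (EuclideanSpace ℝ (Fin 4)) | δ < inner ℝ x (R (EuclideanSpace.single 0 1))} → ∀ F : SchwartzMap (Fin 2 → (EuclideanSpace ℝ (Fin 4))) ℂ, (IsTensorOf F ![((LineDeriv.lineDerivOp (R (EuclideanSpace.single 0 1)) : SchwartzMap (EuclideanSpace ℝ (Fin 4)) ℂ → SchwartzMap (EuclideanSpace ℝ (Fin 4)) ℂ)^[N] f), g] ∨ IsTensorOf F ![f, ((LineDeriv.lineDerivOp (R (EuclideanSpace.single 0 1)) : SchwartzMap (EuclideanSpace ℝ (Fin 4)) ℂ → SchwartzMap (EuclideanSpace ℝ (Fin 4)) ℂ)^[N] g)]) → ‖S₁ 2 F‖ ≤ C * (1 / δ)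 ^ p * schwartzNorm M₀ f * schwartzNorm M₀ g) → (∀ (v : Fin 4 → (EuclideanSpace ℝ (Fin 4))), LinearIndependent ℝ v → ∀ (U V : Set (EuclideanSpace ℝ (Fin 4))), IsOpen U → IsOpen V → ∀ (x₀ y₀ : (EuclideanSpace ℝ (Fin 4))), x₀ ∈ U → y₀ ∈ V → ∀ M₀ : ℕ, ∃ (N₁ : ℕ) (ρ B : ℝ), 0 < ρ ∧ ∀ Λ : SchwartzMap (Fin 2 → (EuclideanSpace ℝ (Fin 4))) ℂ →L[ℂ] ℂ, (∀ (j : Fin 4) (N : ℕ), N ≤ N₁ → ∀ (f g : SchwartzMap (EuclideanSpace ℝ (Fin 4)) ℂ), tsupport (f : (EuclideanSpace ℝ (Fin 4)) → ℂ) ⊆ U → tsupport (g : (EuclideanSpace ℝ (Fin 4)) → ℂ) ⊆ V → ∀ F : SchwartzMap (Fin 2 → (EuclideanSpace ℝ (Fin 4))) ℂ, (IsTensorOf F ![((LineDeriv.lineDerivOp (v j) : SchwartzMap (EuclideanSpace ℝ (Fin 4)) ℂ → SchwartzMap (EuclideanSpace ℝ (Fin 4)) ℂ)^[N] f), g] ∨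 IsTensorOf F ![f, ((LineDeriv.lineDerivOp (v j) : SchwartzMap (EuclideanSpace ℝ (Fin 4)) ℂ → SchwartzMap (EuclideanSpace ℝ (Fin 4)) ℂ)^[N] g)]) → ‖Λ F‖ ≤ schwartzNorm M₀ f * schwartzNorm M₀ g) → ∃ K₂ : (Fin 2 → (EuclideanSpace ℝ (Fin 4))) → ℂ, ContinuousOn K₂ {x : Fin 2 → (EuclideanSpace ℝ (Fin 4)) | x 0 ∈ Metric.ball x₀ ρ ∧ x 1 ∈ Metric.ball y₀ ρ} ∧ (∀ x : Fin 2 → (EuclideanSpace ℝ (Fin 4)), x 0 ∈ Metric.ball x₀ ρ → x 1 ∈ Metric.ball y₀ ρ → ‖K₂ x‖ ≤ B) ∧ ∀ F : SchwartzMap (Fin 2 → (EuclideanSpace ℝ (Fin 4))) ℂ, tsupport (F : (Fin 2 → (EuclideanSpace ℝ (Fin 4))) → ℂ) ⊆ {x : Fin 2 → (EuclideanSpace ℝ (Fin 4)) | x 0 ∈ Metric.ball x₀ ρ ∧ x 1 ∈ Metric.ball y₀ ρ} → MeasureTheory.Integrable (fun x : Fin 2 → (EuclideanSpace ℝ (Fin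 4)) => K₂ x * F x) ∧ Λ F = ∫ x : Fin 2 → (EuclideanSpace ℝ (Fin 4)), K₂ x * F x) → ∀ (S₁ : SchwingerFamily (EuclideanSpace ℝ (Fin 4))), (S₁.toLabelled.IsNormalized ∧ S₁.toLabelled.IsHermitian ∧ S₁.toLabelled.HasLinearGrowth ∧ S₁.toLabelled.IsReflectionPositive ∧ S₁.toLabelled.IsSymmetric ∧ S₁.toLabelled.HasClusterProperty) → (∀ (n : ℕ) (a : (EuclideanSpace ℝ (Fin 4))) (F : SchwartzMap (Fin n → (EuclideanSpace ℝ (Fin 4))) ℂ), IsOffDiagonal F → S₁ n (translateMulti a F) = S₁ n F) → (∀ (R : (EuclideanSpace ℝ (Fin 4)) ≃ₗᵢ[ℝ] (EuclideanSpace ℝ (Fin 4))), LinearMap.det (R.toLinearEquiv : (EuclideanSpace ℝ (Fin 4)) →ₗ[ℝ] (EuclideanSpace ℝ (Fin 4))) = 1 → (∀ i : Fin 4, ∃ j : Fin 4, R (EuclideanSpace.single i 1) = EuclideanSpace.single j 1 ∨ R (EuclideanSpace.single i 1) = -EuclideanSpace.single j 1) → ∀ (n : ℕ) (F : SchwartzMap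 (Fin n → (EuclideanSpace ℝ (Fin 4))) ℂ), IsOffDiagonal F → S₁ n (linActMulti R F) = S₁ n F) → (∀ (R : (EuclideanSpace ℝ (Fin 4)) ≃ₗᵢ[ℝ] (EuclideanSpace ℝ (Fin 4))) (a b : ℝ), a ^ 2 = 1 / 2 → b ^ 2 = 1 / 2 → R (EuclideanSpace.single 0 1) = a • EuclideanSpace.single 0 1 + b • EuclideanSpace.single 1 1 → (SchwingerFamily.toLabelled (fun n => (S₁ n).comp (linActMulti R))).IsReflectionPositive) → ∃ K : (EuclideanSpace ℝ (Fin 4)) → ℂ, ContinuousOn K {x : (EuclideanSpace ℝ (Fin 4)) | x ≠ 0} ∧ (∃ (A : ℝ) (p : ℕ), ∀ x : (EuclideanSpace ℝ (Fin 4)), x ≠ 0 → ‖K x‖ ≤ A * (‖x‖ ^ p + ‖x‖⁻¹ ^ p)) ∧ ∀ F : SchwartzMap (Fin 2 → (EuclideanSpace ℝ (Fin 4))) ℂ, HasCompactSupport (F : (Fin 2 → (EuclideanSpace ℝ (Fin 4))) → ℂ) → tsupport (F : (Fin 2 → (EuclideanSpace ℝ (Fin 4))) → ℂ) ⊆ {x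 : Fin 2 → (EuclideanSpace ℝ (Fin 4)) | x 0 ≠ x 1} → MeasureTheory.Integrable (fun x : Fin 2 → (EuclideanSpace ℝ (Fin 4)) => K (x 0 - x 1) * F x) ∧ S₁ 2 F = ∫ x : Fin 2 → (EuclideanSpace ℝ (Fin 4)), K (x 0 - x 1) * F x := by
  sorry

/-- Stub A4, registered form (statement verbatim = def `OffDiagonalExtension`). -/
theorem OffDiagonalExtension : open Literature.MathematicalPhysics.QuantumLattice Literature.MathematicalPhysics.AQFT Literature.MathematicalPhysics.QuantumFieldTheory in ∀ (T : SchwartzMap (Fin 2 → (EuclideanSpace ℝ (Fin 4))) ℂ →L[ℂ] ℂ) (K : (EuclideanSpace ℝ (Fin 4)) → ℂ), ContinuousOn K {x : (EuclideanSpace ℝ (Fin 4)) | x ≠ 0} → (∃ (A : ℝ) (p : ℕ), ∀ x : (EuclideanSpace ℝ (Fin 4)), x ≠ 0 → ‖K x‖ ≤ A * (‖x‖ ^ p + ‖x‖⁻¹ ^ p)) → (∀ F : SchwartzMap (Fin 2 → (EuclideanSpace ℝ (Fin 4))) ℂ, HasCompactSupport (F : (Fin 2 → (EuclideanSpace ℝ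 (Fin 4))) → ℂ) → tsupport (F : (Fin 2 → (EuclideanSpace ℝ (Fin 4))) → ℂ) ⊆ {x : Fin 2 → (EuclideanSpace ℝ (Fin 4)) | x 0 ≠ x 1} → MeasureTheory.Integrable (fun x : Fin 2 → (EuclideanSpace ℝ (Fin 4)) => K (x 0 - x 1) * F x) ∧ T F = ∫ x : Fin 2 → (EuclideanSpace ℝ (Fin 4)), K (x 0 - x 1) * F x) → ∀ F : SchwartzMap (Fin 2 → (EuclideanSpace ℝ (Fin 4))) ℂ, IsOffDiagonal F → MeasureTheory.Integrable (fun x : Fin 2 → (EuclideanSpace ℝ (Fin 4)) => K (x 0 - x 1) * F x) ∧ T F = ∫ x : Fin 2 → (EuclideanSpace ℝ (Fin 4)), K (x 0 - x 1) * F x := by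
  sorry

/-- Stub B, registered form (statement verbatim = def `AxisEnvelope`). -/
theorem AxisEnvelope : open Literature.MathematicalPhysics.QuantumLattice Literature.MathematicalPhysics.AQFT Literature.MathematicalPhysics.QuantumFieldTheory in ∀ (S₁ : SchwingerFamily (EuclideanSpace ℝ (Fin 4))) (K : (EuclideanSpace ℝ (Fin 4)) → ℂ), S₁.toLabelled.IsReflectionPositive → (∀ (n : ℕ) (a : (EuclideanSpace ℝ (Fin 4))) (F : SchwartzMap (Fin n → (EuclideanSpace ℝ (Fin 4))) ℂ), IsOffDiagonal F → S₁ n (translateMulti a F) = S₁ n F) → (∀ (R : (EuclideanSpace ℝ (Fin 4)) ≃ₗᵢ[ℝ] (EuclideanSpace ℝ (Fin 4))), LinearMap.det (R.toLinearEquiv : (EuclideanSpace ℝ (Fin 4)) →ₗ[ℝ] (EuclideanSpace ℝ (Fin 4))) = 1 → (∀ i : Fin 4, ∃ j : Fin 4, R (EuclideanSpace.single i 1) = EuclideanSpace.single j 1 ∨ R (EuclideanSpace.single i 1) = -EuclideanSpace.single j 1) → ∀ (n : ℕ) (F : SchwartzMap (Fin n → (EuclideanSpace ℝ (Fin 4)))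 ℂ), IsOffDiagonal F → S₁ n (linActMulti R F) = S₁ n F) → ContinuousOn K {x : (EuclideanSpace ℝ (Fin 4)) | x ≠ 0} → (∀ F : SchwartzMap (Fin 2 → (EuclideanSpace ℝ (Fin 4))) ℂ, IsOffDiagonal F → MeasureTheory.Integrable (fun x : Fin 2 → (EuclideanSpace ℝ (Fin 4)) => K (x 0 - x 1) * F x) ∧ S₁ 2 F = ∫ x : Fin 2 → (EuclideanSpace ℝ (Fin 4)), K (x 0 - x 1) * F x) → (∀ s : ℝ, 0 < s → (K (EuclideanSpace.single 0 s)).im = 0 ∧ 0 ≤ (K (EuclideanSpace.single 0 s)).re) ∧ AntitoneOn (fun s : ℝ => (K (EuclideanSpace.single 0 s)).re) (Set.Ioi 0) ∧ (∀ x : (EuclideanSpace ℝ (Fin 4)), x ≠ 0 → ‖K x‖ ≤ (K (EuclideanSpace.single 0 (‖x‖ / 2))).re) := by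
  sorry

/-- Stub E, registered form (statement verbatim = def `AxialGrowth`). -/
theorem AxialGrowth : open Literature.MathematicalPhysics.QuantumLattice Literature.MathematicalPhysics.AQFT Literature.MathematicalPhysics.QuantumFieldTheory in ∀ (G : Type) [Group G] [TopologicalSpace G] [IsTopologicalGroup G] [CompactSpace G] [MeasurableSpace G] [BorelSpace G], IsCompactSimpleLieGroup G → ∀ (r : LatticeRep G) (sch : SpeciesScheme (YMSpecies G)) (S₁ : SchwingerFamily (EuclideanSpace ℝ (Fin 4))), ((∀ (n : ℕ), n ≠ 0 → ∀ (f : Fin n → SchwartzMap (EuclideanSpace ℝ (Fin 4)) ℝ) (F : SchwartzMap (Fin n → (EuclideanSpace ℝ (Fin 4))) ℂ), IsTensorOf F (fun i => ofRealTest (f i)) → IsOffDiagonal F → Filter.Tendsto (fun k : ℕ => ((latticeSchwinger r.ρ sch (fun s => s.F) k n (fun _ => r.curvature) f : ℝ) : ℂ)) Filter.atTop (nhds (S₁ n F))) ∧ (S₁.toLabelled.IsNormalized ∧ S₁.toLabelled.IsHermitian ∧ S₁.toLabelled.HasLinearGrowth ∧ S₁.toLabelled.IsReflectionPositive ∧ S₁.toLabelled.IsSymmetric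 ∧ S₁.toLabelled.HasClusterProperty) ∧ (∀ (n : ℕ) (a : (EuclideanSpace ℝ (Fin 4))) (F : SchwartzMap (Fin n → (EuclideanSpace ℝ (Fin 4))) ℂ), IsOffDiagonal F → S₁ n (translateMulti a F) = S₁ n F) ∧ (∀ (R : (EuclideanSpace ℝ (Fin 4)) ≃ₗᵢ[ℝ] (EuclideanSpace ℝ (Fin 4))), LinearMap.det (R.toLinearEquiv : (EuclideanSpace ℝ (Fin 4)) →ₗ[ℝ] (EuclideanSpace ℝ (Fin 4))) = 1 → (∀ i : Fin 4, ∃ j : Fin 4, R (EuclideanSpace.single i 1) = EuclideanSpace.single j 1 ∨ R (EuclideanSpace.single i 1) = -EuclideanSpace.single j 1) → ∀ (n : ℕ) (F : SchwartzMap (Fin n → (EuclideanSpace ℝ (Fin 4))) ℂ), IsOffDiagonal F → S₁ n (linActMulti R F) = S₁ n F) ∧ (∃ Δ : ℝ, 0 < Δ ∧ S₁.toLabelled.HasMassGap Δ ∧ HasLatticeMassGap r sch Δ)) → ∀ (K : (EuclideanSpace ℝ (Fin 4)) → ℂ), ContinuousOn K {x : (EuclideanSpace ℝ (Fin 4)) |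 x ≠ 0} → (∀ F : SchwartzMap (Fin 2 → (EuclideanSpace ℝ (Fin 4))) ℂ, IsOffDiagonal F → MeasureTheory.Integrable (fun x : Fin 2 → (EuclideanSpace ℝ (Fin 4)) => K (x 0 - x 1) * F x) ∧ S₁ 2 F = ∫ x : Fin 2 → (EuclideanSpace ℝ (Fin 4)), K (x 0 - x 1) * F x) → ∃ C η : ℝ, 0 < η ∧ ∀ s : ℝ, 0 < s → s ≤ 1 → ‖K (EuclideanSpace.single 0 s)‖ ≤ C * s ^ (η - 10) := by
  sorry

end Stub

/-! ## The composition (kernel-checked; no `sorry` below this line) -/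

/-- **A from A1–A4** (the reshape's glue): the off-diagonal kernel of `KernelOffDiagonal` fed to `OffDiagonalExtension`
with `T := S₁ 2`. [folklore] -/
theorem mirrorChartRegularity_of (h₁ : ChartDerivativeBounds) (h₂ : TensorRegularity) (h₃ : KernelOffDiagonal)
    (h₄ : OffDiagonalExtension) : MirrorChartRegularity := by
  intro S₁ hpkg htr hhyp hdiag
  obtain ⟨K, hcont, hbd, hrep⟩ := h₃ h₁ h₂ S₁ hpkg htr hhyp hdiag
  exact ⟨K, hcont, h₄ (S₁ 2) K hcont hbd hrep⟩

/-- **C is landed**: `LatticeReality` is the tree theorem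
`Summit.QuantumFields.YangMills.Theorems.CurvatureKernel.LatticeReality` (p71949). [folklore] -/
theorem latticeReality_holds : LatticeReality :=
  Summit.QuantumFields.YangMills.Theorems.CurvatureKernel.LatticeReality

/-- **`CurvatureKernelBound_of`** — the glue of the line, over exactly the seven registered stubs. From the four
diagonal frames (D), the complex kernel `K` continuous off `0` (A, assembled from A1–A4 by `mirrorChartRegularity_of`),
its reality off `0` (C, LANDED, fed by the real lattice limits in `W₁`), the axial envelope (B) and the axial growth
bound (E): `K_real := re ∘ K` is continuous off `0`, represents `S₁ 2` on `⁰𝒮` (the integrands agree: off the diagonal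
`K` is real, on the diagonal `F` vanishes), and `|K_real x| ≤ ‖K x‖ ≤ k(‖x‖/2)`, which is `≤ C (‖x‖/2)^(η−10)` for
`‖x‖ ≤ 1` and `≤ k(1/2)` for `‖x‖ ≥ 1` (monotonicity; no gap, no clustering). -/
theorem CurvatureKernelBound_of
    (hD : Summit.QuantumFields.YangMills.Theses.PencilRigidity.DiagonalMirrorRPR)
    (h₁ : ChartDerivativeBounds) (h₂ : TensorRegularity) (h₃ : KernelOffDiagonal) (h₄ : OffDiagonalExtension)
    (hB : AxisEnvelope) (hE : AxialGrowth) :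
    Summit.QuantumFields.YangMills.Theses.PencilRigidity.CurvatureKernelBound := by
  have hA : MirrorChartRegularity := mirrorChartRegularity_of h₁ h₂ h₃ h₄
  have hC : LatticeReality := latticeReality_holds
  intro G _ _ _ _ hG W₁ r sch S₁ hW₁
  letI : MeasurableSpace G := borel G
  haveI : BorelSpace G := ⟨rfl⟩
  obtain ⟨hconv, hpkg, htr, hhyp, hgap⟩ := hW₁
  -- (D) the four diagonal frames, from the route's own crux
  have hdiag := hD G hG r sch S₁ ⟨hconv, hpkg, htr, hhyp, hgap⟩
  -- (A) the complex kernel, continuous off 0, representing S₁ 2 on ⁰𝒮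
  obtain ⟨K, hcont, hrep⟩ := hA S₁ hpkg htr hhyp hdiag
  -- reality of S₁ 2 on real off-diagonal tensors: a limit of real lattice correlations
  have hrealS : ∀ (f : Fin 2 → SchwartzMap (EuclideanSpace ℝ (Fin 4)) ℝ)
      (F : SchwartzMap (Fin 2 → EuclideanSpace ℝ (Fin 4)) ℂ),
      IsTensorOf F (fun i => ofRealTest (f i)) → IsOffDiagonal F → (S₁ 2 F).im = 0 := by
    intro f F hF hoff
    have ht := hconv 2 (by norm_num) f F hF hoff
    have hc := (Complex.continuous_im.tendsto _).comp ht
    have h0 : Filter.Tendsto (fun _ : ℕ => (0 : ℝ)) Filter.atTop (nhds (S₁ 2 F).im) :=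
      hc.congr (fun k => by simp)
    exact (tendsto_const_nhds_iff.mp h0).symm
  -- (C) the kernel is real off 0
  have him : ∀ x, x ≠ 0 → (K x).im = 0 := hC S₁ K hcont hrep hrealS
  -- (B) the axial envelope (axis reflection positivity only)
  obtain ⟨hpos, hmono, henv⟩ := hB S₁ K hpkg.2.2.2.1 htr hhyp hcont hrep
  -- (E) the UV datum: growth of k(s) = K(s e₀) on (0, 1]
  obtain ⟨C, η, hη, hax⟩ := hE G hG r sch S₁ ⟨hconv, hpkg, htr, hhyp, hgap⟩ K hcont hrep
  -- constants
  set k₀ : ℝ := (K (EuclideanSpace.single 0 (1 / 2 : ℝ))).re with hk₀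
  have hk₀nn : 0 ≤ k₀ := (hpos (1 / 2) (by norm_num)).2
  have h2pos : (0 : ℝ) < 2 ^ (η - 10) := Real.rpow_pos_of_pos (by norm_num) _
  set C₁ : ℝ := |C| / 2 ^ (η - 10) with hC₁
  have hC₁nn : 0 ≤ C₁ := div_nonneg (abs_nonneg C) h2pos.le
  refine ⟨fun x => (K x).re, k₀ + C₁, η, hη, ?_, ?_, ?_⟩
  · -- continuity off 0
    exact Complex.continuous_re.comp_continuousOn hcont
  · -- the bound |K_real x| ≤ (k₀ + C₁) (1 + ‖x‖^(η-10))
    intro x hx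
    have htpos : 0 < ‖x‖ := norm_pos_iff.mpr hx
    have hrnn : 0 ≤ ‖x‖ ^ (η - 10) := Real.rpow_nonneg htpos.le _
    have h1 : |(K x).re| ≤ (K (EuclideanSpace.single 0 (‖x‖ / 2))).re :=
      (Complex.abs_re_le_norm _).trans (henv x hx)
    by_cases hle : ‖x‖ ≤ 1
    · have h2 : (K (EuclideanSpace.single 0 (‖x‖ / 2))).re ≤ C * (‖x‖ / 2) ^ (η - 10) :=
        (Complex.re_le_norm _).trans (hax (‖x‖ / 2) (half_pos htpos) (by linarith))
      have h3 : C * (‖x‖ / 2) ^ (η - 10) ≤ C₁ * ‖x‖ ^ (η - 10) := by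
        rw [Real.div_rpow htpos.le zero_le_two, hC₁]
        calc C * (‖x‖ ^ (η - 10) / 2 ^ (η - 10))
            ≤ |C| * (‖x‖ ^ (η - 10) / 2 ^ (η - 10)) :=
              mul_le_mul_of_nonneg_right (le_abs_self C) (div_nonneg hrnn h2pos.le)
          _ = |C| / 2 ^ (η - 10) * ‖x‖ ^ (η - 10) := by ring
      calc |(K x).re| ≤ C₁ * ‖x‖ ^ (η - 10) := h1.trans (h2.trans h3)
        _ ≤ (k₀ + C₁) * ‖x‖ ^ (η - 10) := by nlinarith [hk₀nn, hrnn]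
        _ ≤ (k₀ + C₁) * (1 + ‖x‖ ^ (η - 10)) := by nlinarith [hk₀nn, hC₁nn, hrnn]
    · have hlt : 1 < ‖x‖ := lt_of_not_ge hle
      have h2 : (K (EuclideanSpace.single 0 (‖x‖ / 2))).re ≤ k₀ :=
        hmono (Set.mem_Ioi.mpr (by norm_num : (0 : ℝ) < 1 / 2)) (Set.mem_Ioi.mpr (half_pos htpos))
          (by linarith)
      calc |(K x).re| ≤ k₀ := h1.trans h2
        _ ≤ (k₀ + C₁) * 1 := by linarith [hC₁nn]
        _ ≤ (k₀ + C₁) * (1 + ‖x‖ ^ (η - 10)) := by nlinarith [hk₀nn, hC₁nn, hrnn]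
  · -- the representation on ⁰𝒮 with the real kernel: the integrands coincide pointwise
    intro F hF
    have hfun : (fun y : Fin 2 → EuclideanSpace ℝ (Fin 4) => (((K (y 0 - y 1)).re : ℝ) : ℂ) * F y) =
        fun y => K (y 0 - y 1) * F y := by
      funext y
      by_cases h : y 0 = y 1
      · have hy : y ∈ coincidenceLocus 2 (EuclideanSpace ℝ (Fin 4)) :=
          (mem_coincidenceLocus y).mpr ⟨0, 1, by decide, h⟩
        simp [hF.apply_eq_zero hy]
      · have hne : y 0 - y 1 ≠ 0 := sub_ne_zero.mpr h
        congr 1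
        exact Complex.ext (by simp) (by simp [him _ hne])
    obtain ⟨hint, hSF⟩ := hrep F hF
    refine ⟨?_, ?_⟩
    · rw [hfun]; exact hint
    · rw [hfun]; exact hSF

/-- **The skeleton**: the crux modulo exactly the seven registered stubs `Stub.*` (C landed, A glued from A1–A4). -/
theorem CurvatureKernelBound_proof :
    Summit.QuantumFields.YangMills.Theses.PencilRigidity.CurvatureKernelBound :=
  CurvatureKernelBound_of Stub.DiagonalMirrorRPR Stub.ChartDerivativeBounds Stub.TensorRegularity
    Stub.KernelOffDiagonal Stub.OffDiagonalExtension Stub.AxisEnvelope Stub.AxialGrowth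

end Summit.QuantumFields.YangMills.Cruxes.CurvatureKernelBound.SixteenChartsAnalyticKernel
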